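import Literature.NumberTheory.EllipticCurves.Kato2004.ZetaIndexInequalitySkeletonProofs
import Literature.NumberTheory.EllipticCurves.Kato2004.MainConjectureSkeletonProofs
import HarnessLib

/-!
# Kato 2004, Thm. 12.5 (3) WITH its local term `𝐇²_loc` at the one exceptional prime of (12.5.1): the
# descent §14.14–14.15 and the §17.13 bookkeeping run with a length defect at ONE height-one prime,
# PROVED as module theory over `Λ = ℤ_p⟦T⟧` (companion of `ZetaIndexInequalitySkeletonProofs` and
# `MainConjectureSkeletonProofs`)

K. Kato, *`p`-adic Hodge theory and values of zeta functions of modular forms*, Astérisque **295**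
(2004) [Kato2004Asterisque]. Thm. 12.5 (3) (p. 222) is printed WITH a local term: "Let `𝔭` be a prime
ideal of `Λ` of height one which does not contain `p`. Then
`length_{Λ_𝔭}(𝐇²(V_{F_λ}(f))_𝔭) ≤ length_{Λ_𝔭}(𝐇¹(V_{F_λ}(f))_𝔭/Z(f)_𝔭) + length_{Λ_𝔭}(𝐇²_loc(V_{F_λ}(f))_𝔭)`.
If `𝐇²_loc(V_{F_λ}(f))_𝔭 ≠ 0`, then `f` and `𝔭` satisfy the following (12.5.1): `k = 2`, `f` is not
potentially of good reduction at `p` (12.7), `𝔭` is the kernel of the ring homomorphism `Λ → F_λ`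
induced by `κ^{-2}χ : G_∞ → F_λ^×` for some homomorphism `χ : G_∞ → F_λ^×` of finite order, and
`length_{Λ_𝔭}(𝐇²_loc(V_{F_λ}(f))_𝔭) = 1`"; Thm. 12.5 (4) prints the inequality WITHOUT the local term
"for any prime ideal of `Λ` of height one unless `f` and `𝔭` satisfy (12.5.1) in (3)"; and Conj. 12.10
(p. 224) prints the EQUALITY `length_{Λ_𝔭}(𝐇²(T)_𝔭) = length_{Λ_𝔭}(𝐇¹(T)_𝔭/Z(f,T)_𝔭)` for every
height-one `𝔭` (at `p = 2`: `𝔭 ∌ 2`), the exceptional prime of (12.5.1) included.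

So at the ONE exceptional prime `𝔮₀` the printed divisibility is weaker than the conjecture by the
length `e = 1` of the local term. The tree's `ZetaIndexInequalitySkeletonProofs` (Thm. 14.5 (3) as
algebra) and `MainConjectureSkeletonProofs` (§17.13: 12.10 ⟺ 17.6 prime by prime) take the
inequality / the finiteness of `𝐇²_loc` at EVERY height-one prime. This file records, as pure module
theory over `Λ = IwasawaAlgebra p = ℤ_p⟦T⟧` and with Kato's objects as VARIABLES (nothing about them
is defined or asserted), what the SAME arguments give when ONE height-one prime `𝔮₀ ≠ (T)` carries a
defect `d`:

* `Kato2004.eulerExp_le_add_of_lengthAt_le_off_prime` — `ℓ_𝔮(M) ≤ ℓ_𝔮(N)` at every height-one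
  `𝔮 ≠ (T), 𝔮₀` and `ℓ_{𝔮₀}(M) ≤ ℓ_{𝔮₀}(N) + d` ⟹ `e(M) ≤ e(N) + d·v_p(q_{𝔮₀}(0))` for the `Γ`-Euler
  exponent `e` of Lemma 14.15 (`IwasawaAlgebra.eulerExp`; the weight of `𝔮₀ = (q_{𝔮₀})` in the
  descent to the trivial character is `#Λ/(q_{𝔮₀}, T) = p^{v_p(q_{𝔮₀}(0))}`).
* `Kato2004.natCard_coinvariants_le_pow_mul_index_zeta_of_lengthAt_le_off_prime` — §14.14 with that
  input: along (14.14.1)–(14.14.2), **`#(H2/TH2) ≤ p^{d·v_p(q_{𝔮₀}(0))} · [A : Λ·ι z̄]`**, i.e.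
  Thm. 14.5 (3) `#H²(ℤ[1/p],T) ≤ [H¹(ℤ[1/p],T) : z]` with the extra factor `p^{d·v_p(q_{𝔮₀}(0))}` —
  the exact place where the local term of 12.5 (3) enters the `p`-part of the Birch–Swinnerton-Dyer
  bound in analytic rank `0` (at `p = 2`, `𝔮₀ = (γ − κ(γ)^{-1})`, `γ ↔ 5`: factor `2^{v₂(4/5)} = 4`; cell
  `bsd-2adic`, seat `addL2x`, readings T17/T18 and repair-census entry R-B76).
* `Kato2004.lengthAt_add_eq_of_skeleton_exceptional` — §17.13's identity
  `ℓ(X)_𝔭 + ℓ(H/Z)_𝔭 = ℓ(R/(G))_𝔭 + ℓ(H2)_𝔭` at a prime where the local term `ε(H2) ⊂ H2loc` has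
  length `e` AND the zeta line meets the Coleman map with the same excess (`ℓ(R/col(loc Z))_𝔭 =
  ℓ(R/(G))_𝔭 + e`, `col` injective with `ℓ(R/col P)_𝔭 = 0`): the two defects CANCEL, so at such a prime
  Conj. 12.10 (`ℓ(H2) = ℓ(H/Z)`) is again EQUIVALENT to Conj. 17.6 (`ℓ(X) = ℓ(R/(G))`)
  (`…_iff_…_exceptional`), while Thm. 12.5 (3) (`ℓ(H2) ≤ ℓ(H/Z) + e`) gives only
  `ℓ(X) ≤ ℓ(R/(G)) + e` (`lengthAt_le_add_of_skeleton_exceptional`).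

Theorems only; no definition, no named fact (D-0014/D-0026). The identification of `M, N, H, z, H2, A,
P, X, col, G` with Kato's `𝐇²`, `𝐇¹/Z(f,T)`, `H^i(ℤ[1/p],T)`, `𝐇¹_loc/𝐇¹_loc(T')`, `𝔛`, the Coleman map
and the `p`-adic `L`-function is NOT made here (it is the business of the readers of these lemmas).

References: [Kato2004Asterisque] Thm. 12.5 (3)(4) and (12.5.1) (p. 222), Conj. 12.10 (p. 224), 13.13
(pp. 233–234), §14.14 and Lemma 14.15 (pp. 243–244), §17.13 (p. 280); [GreenbergLNM1716] §4 Lemma 4.2;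
[Washington1997] §13.2.
-/

noncomputable section

open scoped Classical

universe u

namespace Literature.NumberTheory.EllipticCurves.Kato2004

open Literature.NumberTheory.EllipticCurves.IwasawaAlgebra

variable {p : ℕ} [Fact p.Prime]

/-! ### §1 The `Γ`-Euler exponent with a defect at one height-one prime -/

section OffPrime

variable {M N : Type u} [AddCommGroup M] [Module (IwasawaAlgebra p) M]
  [AddCommGroup N] [Module (IwasawaAlgebra p) N]
  [Module.Finite (IwasawaAlgebra p) M] [Module.Finite (IwasawaAlgebra p) N]

/-- **`e(M) ≤ e(N) + d · v_p(q_{𝔮₀}(0))` when `ℓ_𝔮(M) ≤ ℓ_𝔮(N)` at every height-one prime `𝔮 ≠ (T)`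
other than `𝔮₀`, and `ℓ_{𝔮₀}(M) ≤ ℓ_{𝔮₀}(N) + d`** (both modules finitely generated torsion; `𝔮₀` a
height-one prime `≠ (T)`). This is Kato's Thm. 12.5 (3) — the divisibility of Thm. 12.5 (4) at every
height-one prime EXCEPT the exceptional prime `𝔮₀` of (12.5.1), where the local term `𝐇²_loc` of length
`d = 1` is added — fed into the `Γ`-Euler exponent of Lemma 14.15 (the tree's
`eulerExp_le_of_lengthAt_le` is the case `d = 0`; `eulerExp_le_add_muInvariant_of_lengthAt_le_off_p` is
the same bookkeeping with the exception at `(p)`).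
[cite: Kato2004Asterisque, Thm. 12.5 (3)(4) and (12.5.1) (p. 222), Lemma 14.15 (p. 244)] -/
theorem eulerExp_le_add_of_lengthAt_le_off_prime (hM : Module.IsTorsion (IwasawaAlgebra p) M)
    (hN : Module.IsTorsion (IwasawaAlgebra p) N) (𝔮₀ : PrimeSpectrum (IwasawaAlgebra p))
    (h𝔮₀ : 𝔮₀ ∈ heightOneNeT p) (d : ℕ)
    (h : ∀ 𝔮 : PrimeSpectrum (IwasawaAlgebra p), 𝔮 ∈ heightOneNeT p → 𝔮 ≠ 𝔮₀ →
      Module.lengthAt (IwasawaAlgebra p) M 𝔮 ≤ Module.lengthAt (IwasawaAlgebra p) N 𝔮)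
    (h₀ : Module.lengthAt (IwasawaAlgebra p) M 𝔮₀ ≤ Module.lengthAt (IwasawaAlgebra p) N 𝔮₀ + d) :
    eulerExp p M ≤ eulerExp p N + d * constVal p 𝔮₀ := by
  -- a common finite index set containing `𝔮₀`
  have hSM := finite_heightOneNeT_inter_support M hM
  have hSN := finite_heightOneNeT_inter_support N hN
  set S : Finset (PrimeSpectrum (IwasawaAlgebra p)) := (hSM.union hSN).toFinset ∪ {𝔮₀} with hS
  have hsubM : heightOneNeT p ∩ Function.support (fun 𝔮 ↦
      (Module.lengthAt (IwasawaAlgebra p) M 𝔮).toNat * constVal p 𝔮) ⊆ S := by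
    intro x hx
    rw [hS, Finset.coe_union, Set.Finite.coe_toFinset]
    exact Or.inl (Or.inl hx)
  have hsubN : heightOneNeT p ∩ Function.support (fun 𝔮 ↦
      (Module.lengthAt (IwasawaAlgebra p) N 𝔮).toNat * constVal p 𝔮) ⊆ S := by
    intro x hx
    rw [hS, Finset.coe_union, Set.Finite.coe_toFinset]
    exact Or.inl (Or.inr hx)
  have hSsub : (S : Set (PrimeSpectrum (IwasawaAlgebra p))) ⊆ heightOneNeT p := by
    intro x hx
    rw [hS, Finset.coe_union, Set.Finite.coe_toFinset, Finset.coe_singleton] at hx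
    rcases hx with (hx | hx) | hx
    · exact hx.1
    · exact hx.1
    · rw [Set.mem_singleton_iff] at hx; rw [hx]; exact h𝔮₀
  have h𝔮₀S : 𝔮₀ ∈ S := by rw [hS]; exact Finset.mem_union_right _ (Finset.mem_singleton_self _)
  have eM : eulerExp p M = ∑ 𝔮 ∈ S, (Module.lengthAt (IwasawaAlgebra p) M 𝔮).toNat * constVal p 𝔮 :=
    finsum_mem_eq_sum_of_subset _ hsubM hSsub
  have eN : eulerExp p N = ∑ 𝔮 ∈ S, (Module.lengthAt (IwasawaAlgebra p) N 𝔮).toNat * constVal p 𝔮 :=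
    finsum_mem_eq_sum_of_subset _ hsubN hSsub
  -- pointwise bound with a correction supported at `𝔮₀`
  have hle : ∀ i ∈ S, (Module.lengthAt (IwasawaAlgebra p) M i).toNat * constVal p i ≤
      (Module.lengthAt (IwasawaAlgebra p) N i).toNat * constVal p i +
        (if i = 𝔮₀ then d * constVal p 𝔮₀ else 0) := by
    intro i hi
    have hi' := hSsub (Finset.mem_coe.mpr hi)
    have hNtop : Module.lengthAt (IwasawaAlgebra p) N i ≠ ⊤ :=
      IwasawaAlgebra.lengthAt_ne_top_of_isTorsion N hN i (le_of_eq hi'.1)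
    by_cases hi𝔮 : i = 𝔮₀
    · subst hi𝔮
      rw [if_pos rfl, ← add_mul]
      refine Nat.mul_le_mul_right _ ?_
      have hMtop : Module.lengthAt (IwasawaAlgebra p) M i ≠ ⊤ :=
        IwasawaAlgebra.lengthAt_ne_top_of_isTorsion M hM i (le_of_eq hi'.1)
      have key : ((Module.lengthAt (IwasawaAlgebra p) M i).toNat : ℕ∞) ≤
          ((Module.lengthAt (IwasawaAlgebra p) N i).toNat : ℕ∞) + (d : ℕ∞) := by
        rw [ENat.coe_toNat hMtop, ENat.coe_toNat hNtop]; exact h₀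
      exact_mod_cast key
    · rw [if_neg hi𝔮, add_zero]
      exact Nat.mul_le_mul_right _ (ENat.toNat_le_toNat (h i hi' hi𝔮) hNtop)
  have hsum := Finset.sum_le_sum hle
  rw [Finset.sum_add_distrib, Finset.sum_ite_eq' S 𝔮₀, if_pos h𝔮₀S] at hsum
  rw [eM, eN]
  exact hsum

end OffPrime

/-! ### §2 §14.14 with the defect: Thm. 14.5 (3) up to the factor `p^{d · v_p(q_{𝔮₀}(0))}` -/

section Descent

variable {H H2 A : Type u} [AddCommGroup H] [Module (IwasawaAlgebra p) H]
  [AddCommGroup H2] [Module (IwasawaAlgebra p) H2] [AddCommGroup A] [Module (IwasawaAlgebra p) A]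
  [Module.Finite (IwasawaAlgebra p) H] [NoZeroSMulDivisors (IwasawaAlgebra p) H]
  [Module.Finite (IwasawaAlgebra p) H2]

/-- **§14.14 run with Thm. 12.5 (3) INCLUDING its local term at one exceptional prime:
`#(H2/TH2) ≤ p^{d·v_p(q_{𝔮₀}(0))} · [A : Λ·ι z̄]`.** Data as in
`exists_index_zeta_eq_pow_mul_natCard_coinvariants_of_lengthAt_le` (`H` = `𝐇¹` torsion free,
`z ∈ H` the zeta element with `H/Λz` torsion, `H2` = `𝐇²` torsion, the exact sequence (14.14.1)
`0 → H/TH →ι A →π H2[T] → 0` with `A` = `H¹(ℤ[1/p],T)`, `H2/TH2` (`= H²(ℤ[1/p],T)`, (14.14.2)) finite,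
`(H/Λz)/T` finite), but with the divisibility `ℓ_𝔮(H2) ≤ ℓ_𝔮(H/Λz)` assumed only at the height-one
primes `𝔮 ≠ (T), 𝔮₀`, and `ℓ_{𝔮₀}(H2) ≤ ℓ_{𝔮₀}(H/Λz) + d` at the exceptional `𝔮₀ ≠ (T)` (Thm. 12.5 (3)
with `d = length 𝐇²_loc,𝔮₀ = 1` under (12.5.1)). Then `#(H2/TH2) = #H2[T]·p^{e(H2)}`,
`[A : Λ·ι z̄] = #H2[T]·p^{e(H/Λz)}` (Lemma 14.15) and §1 give the displayed inequality — Kato's (★)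
`#H²(ℤ[1/p],T) ≤ [H¹(ℤ[1/p],T) : z]` of Thm. 14.5 (3) weakened by exactly `p^{d·v_p(q_{𝔮₀}(0))}`.
[cite: Kato2004Asterisque, Thm. 12.5 (3) and (12.5.1) (p. 222), Thm. 14.5 (3) (p. 236), §14.14 (14.14.1)–(14.14.2) and Lemma 14.15 (pp. 243–244)] -/
theorem natCard_coinvariants_le_pow_mul_index_zeta_of_lengthAt_le_off_prime (z : H) (hz : z ≠ 0)
    (hHZ : Module.IsTorsion (IwasawaAlgebra p) (H ⧸ (IwasawaAlgebra p) ∙ z))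
    (hH2 : Module.IsTorsion (IwasawaAlgebra p) H2)
    (𝔮₀ : PrimeSpectrum (IwasawaAlgebra p)) (h𝔮₀ : 𝔮₀ ∈ heightOneNeT p) (d : ℕ)
    (hdiv : ∀ 𝔮 : PrimeSpectrum (IwasawaAlgebra p), 𝔮 ∈ heightOneNeT p → 𝔮 ≠ 𝔮₀ →
      Module.lengthAt (IwasawaAlgebra p) H2 𝔮 ≤
        Module.lengthAt (IwasawaAlgebra p) (H ⧸ (IwasawaAlgebra p) ∙ z) 𝔮)
    (hdiv₀ : Module.lengthAt (IwasawaAlgebra p) H2 𝔮₀ ≤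
        Module.lengthAt (IwasawaAlgebra p) (H ⧸ (IwasawaAlgebra p) ∙ z) 𝔮₀ + d)
    (ι : coinvariants p H →ₗ[IwasawaAlgebra p] A) (π : A →ₗ[IwasawaAlgebra p] invariants p H2)
    (hι : Function.Injective ι) (hπ : Function.Surjective π) (hex : Function.Exact ι π)
    (hfin : Finite (coinvariants p H2))
    (hfinZ : Finite (coinvariants p (H ⧸ (IwasawaAlgebra p) ∙ z))) :
    Nat.card (coinvariants p H2) ≤
      p ^ (d * constVal p 𝔮₀) * Nat.card (A ⧸ (IwasawaAlgebra p) ∙ ι (Submodule.Quotient.mk z)) := by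
  set Q := H ⧸ (IwasawaAlgebra p) ∙ z with hQ
  obtain ⟨-, hcard2⟩ := natCard_coinvariants_eq_of_finite H2 hH2 hfin
  have hTQ : Module.lengthAt (IwasawaAlgebra p) Q (primeT p) = 0 :=
    lengthAt_primeT_eq_zero_of_finite_coinvariants Q hHZ hfinZ
  obtain ⟨hfinQT, -, hcardQ⟩ := card_coinvariants_of_lengthAt_eq_zero Q hHZ hTQ
  rw [natCard_invariants_quotient_span_eq_one z hz hfinQT, one_mul] at hcardQ
  have hle : eulerExp p H2 ≤ eulerExp p Q + d * constVal p 𝔮₀ :=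
    eulerExp_le_add_of_lengthAt_le_off_prime hH2 hHZ 𝔮₀ h𝔮₀ d hdiv hdiv₀
  have hp : 0 < p := (Fact.out : p.Prime).pos
  rw [natCard_quotient_eq_of_exact ι π hι hπ hex, ← natCard_coinvariants_quotient_span z, hcardQ,
    hcard2]
  calc Nat.card (invariants p H2) * p ^ eulerExp p H2
      ≤ Nat.card (invariants p H2) * p ^ (eulerExp p Q + d * constVal p 𝔮₀) :=
        Nat.mul_le_mul_left _ (Nat.pow_le_pow_right hp hle)
    _ = p ^ (d * constVal p 𝔮₀) * (Nat.card (invariants p H2) * p ^ eulerExp p Q) := by ring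

/-- **The sharp case as a corollary (d = 0 at every prime): `#(H2/TH2) ≤ [A : Λ·ι z̄]`** — Thm. 14.5 (3)
as printed, re-derived from the exceptional-prime form with `d = 0` (so that a reader who has Conj. 12.10's
inequality at the exceptional prime too — `ℓ_{𝔮₀}(H2) ≤ ℓ_{𝔮₀}(H/Λz)` — gets Kato's bound with NO extra
factor by the same lemma). [cite: Kato2004Asterisque, Thm. 14.5 (3) (p. 236), Conj. 12.10 (p. 224), §14.14 (p. 243)] -/
theorem natCard_coinvariants_le_index_zeta_of_lengthAt_le_heightOneNeT (z : H) (hz : z ≠ 0)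
    (hHZ : Module.IsTorsion (IwasawaAlgebra p) (H ⧸ (IwasawaAlgebra p) ∙ z))
    (hH2 : Module.IsTorsion (IwasawaAlgebra p) H2)
    (hdiv : ∀ 𝔮 : PrimeSpectrum (IwasawaAlgebra p), 𝔮 ∈ heightOneNeT p →
      Module.lengthAt (IwasawaAlgebra p) H2 𝔮 ≤
        Module.lengthAt (IwasawaAlgebra p) (H ⧸ (IwasawaAlgebra p) ∙ z) 𝔮)
    (ι : coinvariants p H →ₗ[IwasawaAlgebra p] A) (π : A →ₗ[IwasawaAlgebra p] invariants p H2)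
    (hι : Function.Injective ι) (hπ : Function.Surjective π) (hex : Function.Exact ι π)
    (hfin : Finite (coinvariants p H2))
    (hfinZ : Finite (coinvariants p (H ⧸ (IwasawaAlgebra p) ∙ z)))
    (𝔮₀ : PrimeSpectrum (IwasawaAlgebra p)) (h𝔮₀ : 𝔮₀ ∈ heightOneNeT p) :
    Nat.card (coinvariants p H2) ≤ Nat.card (A ⧸ (IwasawaAlgebra p) ∙ ι (Submodule.Quotient.mk z)) := by
  have h := natCard_coinvariants_le_pow_mul_index_zeta_of_lengthAt_le_off_prime z hz hHZ hH2 𝔮₀ h𝔮₀ 0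
    (fun 𝔮 h𝔮 _ ↦ hdiv 𝔮 h𝔮) (by rw [Nat.cast_zero, add_zero]; exact hdiv 𝔮₀ h𝔮₀) ι π hι hπ hex hfin
    hfinZ
  rwa [zero_mul, pow_zero, one_mul] at h

end Descent

/-! ### §3 §17.13 at an exceptional prime: the local term and the Coleman defect cancel -/

section Identity

variable {R : Type*} [CommRing R]
  {H P X H2 H2loc : Type*} [AddCommGroup H] [_root_.Module R H] [AddCommGroup P]
  [_root_.Module R P] [AddCommGroup X] [_root_.Module R X] [AddCommGroup H2] [_root_.Module R H2]
  [AddCommGroup H2loc] [_root_.Module R H2loc]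

/-- **§17.13's identity at a prime where the local term has length `e` and the zeta line meets the
(injective) Coleman map with the same excess: `ℓ(X)_𝔭 + ℓ(H/Z)_𝔭 = ℓ(R/(G))_𝔭 + ℓ(H2)_𝔭`.** Situation of
`lengthAt_skeleton_identity` (`H →loc P →toX X →δ H2 →ε H2loc` exact at `P, X, H2`, `loc` and `col : P → R`
injective, `Z ≤ H`) with, AT `𝔭`: `ℓ(R/col P) = 0`, `ℓ(ε H2) = e` finite (the local term of Thm. 12.5 (3):
`e = 1` at the prime of (12.5.1), `13.13`), and `ℓ(R/col(loc Z)) = ℓ(R/(G)) + e`. The two occurrences of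
`e` cancel in `ℓ(X) + ℓ(H/Z) + ℓ(R/col P) + ℓ(ε H2) = ℓ(R/col(loc Z)) + ℓ(H2)`, so the identity has the
same shape as at an ordinary prime (`lengthAt_add_eq_of_skeleton`). Pure bookkeeping; the identification
with Kato's objects is not made here.
[cite: Kato2004Asterisque, §17.13 (p. 280), Thm. 12.5 (3) and (12.5.1) (p. 222), 13.13 (pp. 233–234)] -/
theorem lengthAt_add_eq_of_skeleton_exceptional (loc : H →ₗ[R] P) (hinj : Function.Injective loc)
    (toX : P →ₗ[R] X) (δ : X →ₗ[R] H2) (ε : H2 →ₗ[R] H2loc)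
    (hPX : Function.Exact loc toX) (hXH : Function.Exact toX δ) (hHE : Function.Exact δ ε)
    (col : P →ₗ[R] R) (hcol : Function.Injective col) (Z : Submodule R H) {G : R}
    (𝔭 : PrimeSpectrum R) (e : ℕ) (hcoker : Module.lengthAt R (R ⧸ LinearMap.range col) 𝔭 = 0)
    (hloc2 : Module.lengthAt R (LinearMap.range ε) 𝔭 = e)
    (hIG : Module.lengthAt R (R ⧸ (Z.map loc).map col) 𝔭 = Module.lengthAt R (R ⧸ Ideal.span {G}) 𝔭 + e) :
    Module.lengthAt R X 𝔭 + Module.lengthAt R (H ⧸ Z) 𝔭 =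
      Module.lengthAt R (R ⧸ Ideal.span {G}) 𝔭 + Module.lengthAt R H2 𝔭 := by
  have h := lengthAt_skeleton_identity loc hinj toX δ ε hPX hXH hHE col hcol Z 𝔭
  rw [hcoker, add_zero, hloc2, hIG, add_right_comm _ (e : ℕ∞) _] at h
  exact (WithTop.add_right_inj (WithTop.natCast_ne_top e)).mp h

/-- **Thm. 12.5 (3) at the exceptional prime gives Thm. 17.4's inequality only up to `e`:** if
`ℓ(H2)_𝔭 ≤ ℓ(H/Z)_𝔭 + e` (the printed inequality with its local term of length `e`) and `ℓ(H/Z)_𝔭` is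
finite, then `ℓ(X)_𝔭 ≤ ℓ(R/(G))_𝔭 + e`. [cite: Kato2004Asterisque, Thm. 12.5 (3) (p. 222), Thm. 17.4 (2) (p. 273), §17.13 (p. 280)] -/
theorem lengthAt_le_add_of_skeleton_exceptional (loc : H →ₗ[R] P) (hinj : Function.Injective loc)
    (toX : P →ₗ[R] X) (δ : X →ₗ[R] H2) (ε : H2 →ₗ[R] H2loc)
    (hPX : Function.Exact loc toX) (hXH : Function.Exact toX δ) (hHE : Function.Exact δ ε)
    (col : P →ₗ[R] R) (hcol : Function.Injective col) (Z : Submodule R H) {G : R}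
    (𝔭 : PrimeSpectrum R) (e : ℕ) (hcoker : Module.lengthAt R (R ⧸ LinearMap.range col) 𝔭 = 0)
    (hloc2 : Module.lengthAt R (LinearMap.range ε) 𝔭 = e)
    (hIG : Module.lengthAt R (R ⧸ (Z.map loc).map col) 𝔭 = Module.lengthAt R (R ⧸ Ideal.span {G}) 𝔭 + e)
    (hfin : Module.lengthAt R (H ⧸ Z) 𝔭 ≠ ⊤)
    (h125 : Module.lengthAt R H2 𝔭 ≤ Module.lengthAt R (H ⧸ Z) 𝔭 + e) :
    Module.lengthAt R X 𝔭 ≤ Module.lengthAt R (R ⧸ Ideal.span {G}) 𝔭 + e := by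
  have h := lengthAt_add_eq_of_skeleton_exceptional loc hinj toX δ ε hPX hXH hHE col hcol Z 𝔭 e hcoker
    hloc2 hIG
  -- `ℓ(X) + ℓ(H/Z) = ℓ(R/(G)) + ℓ(H2) ≤ ℓ(R/(G)) + ℓ(H/Z) + e`
  have h2 : Module.lengthAt R X 𝔭 + Module.lengthAt R (H ⧸ Z) 𝔭 ≤
      (Module.lengthAt R (R ⧸ Ideal.span {G}) 𝔭 + e) + Module.lengthAt R (H ⧸ Z) 𝔭 := by
    rw [h]
    calc Module.lengthAt R (R ⧸ Ideal.span {G}) 𝔭 + Module.lengthAt R H2 𝔭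
        ≤ Module.lengthAt R (R ⧸ Ideal.span {G}) 𝔭 + (Module.lengthAt R (H ⧸ Z) 𝔭 + e) := by gcongr
      _ = (Module.lengthAt R (R ⧸ Ideal.span {G}) 𝔭 + e) + Module.lengthAt R (H ⧸ Z) 𝔭 := by ring
  exact (WithTop.add_le_add_iff_right hfin).mp h2

/-- **Conj. 12.10 at the exceptional prime ⟺ Conj. 17.6 there** (`ℓ(H2) = ℓ(H/Z)` iff `ℓ(X) = ℓ(R/(G))`),
both lengths `ℓ(H/Z)`, `ℓ(R/(G))` being finite: the prime-by-prime equivalence of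
`conj12_10_iff_conj17_6_of_skeleton`-type, now at a prime carrying a local term, because the local term
and the Coleman defect enter the identity with the same length. [cite: Kato2004Asterisque, Conj. 12.10 (p. 224), Conj. 17.6 (p. 274), §17.13 (p. 280)] -/
theorem lengthAt_eq_iff_of_skeleton_exceptional (loc : H →ₗ[R] P) (hinj : Function.Injective loc)
    (toX : P →ₗ[R] X) (δ : X →ₗ[R] H2) (ε : H2 →ₗ[R] H2loc)
    (hPX : Function.Exact loc toX) (hXH : Function.Exact toX δ) (hHE : Function.Exact δ ε)
    (col : P →ₗ[R] R) (hcol : Function.Injective col) (Z : Submodule R H) {G : R}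
    (𝔭 : PrimeSpectrum R) (e : ℕ) (hcoker : Module.lengthAt R (R ⧸ LinearMap.range col) 𝔭 = 0)
    (hloc2 : Module.lengthAt R (LinearMap.range ε) 𝔭 = e)
    (hIG : Module.lengthAt R (R ⧸ (Z.map loc).map col) 𝔭 = Module.lengthAt R (R ⧸ Ideal.span {G}) 𝔭 + e)
    (hfinZ : Module.lengthAt R (H ⧸ Z) 𝔭 ≠ ⊤) (hfinG : Module.lengthAt R (R ⧸ Ideal.span {G}) 𝔭 ≠ ⊤) :
    Module.lengthAt R H2 𝔭 = Module.lengthAt R (H ⧸ Z) 𝔭 ↔ Module.lengthAt R X 𝔭 = Module.lengthAt R (R ⧸ Ideal.span {G}) 𝔭 := by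
  have h := lengthAt_add_eq_of_skeleton_exceptional loc hinj toX δ ε hPX hXH hHE col hcol Z 𝔭 e hcoker
    hloc2 hIG
  constructor
  · intro hMC
    rw [hMC] at h
    exact (WithTop.add_right_inj hfinZ).mp h
  · intro h176
    rw [h176] at h
    exact ((WithTop.add_left_inj hfinG).mp h).symm

end Identity

end Literature.NumberTheory.EllipticCurves.Kato2004

end
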